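import Summits.CriticalPhenomena.PercolationContinuityZ3.Theorems.PercAnnulusCrossingIICSchemePositivity
import HarnessLib

/-!
# Kesten–Basu–Sapozhnikov IIC scheme in boxes, XVI: the hypotheses of Kesten's scheme, level by level (lane RSW3, p1 gen 3)

builds on p205010 (kernel theorem, internal audit signed; external expert review pending)

Seat `prim-rsw3-p1` (gen 3); LANE-4 blueprint, memo `run/shared/lean/prim/rsw3/P1-QM.md` §13.4 step (4).  Helper file; no definitions, no
sorries.  One level: inner annulus outer radius `2mm`, so inner data `C = (H,X)` have `H ⊆ Λ(2mm)`, `X ⊆ Λ(2mm+1)`, `X ∩ H = ∅`; sphere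
parameter `m = 2mm + 1`; inward shell `(2μ₁ − 1, 2μ₂)`; outer annulus `(2M₁, 2M₂)` with data `D = (U,R)`; kernel `M(C;D)`, rank-one
majorant `a(C) β(D)`, level vectors `γ_N`.
* `kernel_le_dat`, `kernel_pos` (`γ_n(C) > 0 ∧ β(D) > 0 ⇒ M(C;D) > 0`), `kernel_eq_zero_of_beta_eq_zero`;
* **`scheme_sum_two_sided`** — hypothesis `hU` of `kesten_multilevel_osc_le` over the INDEX SET
  `s = {D : γ_n(D) > 0, P(DAT(D)) > 0, β(D) > 0}`: `(1 − ε) γ_N(C) ≤ Σ_{D ∈ s} M(C;D) γ_N(D) ≤ γ_N(C)` for `n' ≤ N ≤ n` (`p > 0`; the dropped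
  data contribute nothing, by the positivity transfer of part XIV).
References: H. Kesten, PTRF 73 (1986) §2 eq. (22); D. Basu, A. Sapozhnikov, ECP 22 (2017) no. 26, §2.
-/

noncomputable section

namespace Summit.CriticalPhenomena.PercolationContinuityZ3.Theorems.Crossing

open MeasureTheory Literature.Probability.Percolation Literature.Probability.LatticeModels
open Literature.Probability.Percolation.DCT16
open Summit.CriticalPhenomena.PercolationContinuityZ3.Theorems.SurfaceTension
open scoped Literature.Probability.Percolation

variable {d : ℕ}

/-- `M(C;D) ≤ P(DAT(D))`. [folklore] -/
theorem kernel_le_dat (p : unitInterval) (mm μ₁ μ₂ M₁ M₂ : ℕ) (H X U R : Finset (Site d)) :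
    (bondPercolation (zdGraph d) p).real
        ((⋃ I ∈ (box d (2 * μ₂ - 1) \ box d (2 * μ₁ - 1)).powerset ×ˢ (innerBoundary (zdGraph d) (box d (2 * μ₁ - 1))).powerset,
            ({ω : BondConfig (Site d) | ω ∩ (↑((box d (2 * μ₂)).sym2) : Set (Sym2 (Site d))) ∈
                explEvent ((↑(box d (2 * μ₂ - 1)) : Set (Site d))ᶜ) ((↑(box d (2 * μ₂ - 1)) : Set (Site d)) \ ↑(box d (2 * μ₁ - 1)))
                  ((↑(box d (2 * μ₂ - 1)) : Set (Site d))ᶜ ∪ ↑I.1) ↑I.2} ∩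
             {ω : BondConfig (Site d) | ∀ y ∈ I.2, ∀ y' ∈ I.2, ∀ z ∈ I.1 ∪ innerBoundary (zdGraph d) (box d (2 * μ₂)),
                ∀ z' ∈ I.1 ∪ innerBoundary (zdGraph d) (box d (2 * μ₂)), s(z, y) ∈ ω → s(z', y') ∈ ω →
                ω ∈ openConnIn (↑(I.1 ∪ innerBoundary (zdGraph d) (box d (2 * μ₂))) : Set (Site d)) z z'})) ∩
          ({ω : BondConfig (Site d) | ∃ x ∈ X, ∃ r ∈ R, ∃ v ∈ U, ω ∈ openConnIn ((↑U : Set (Site d)) \ ↑H) x v ∧ s(v, r) ∈ ω} ∩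
           {ω : BondConfig (Site d) | ω ∩ (↑((box d (2 * M₂ + 1)).sym2) : Set (Sym2 (Site d))) ∈
            explEvent (↑(box d (2 * M₁)) : Set (Site d)) ((↑(box d (2 * M₂)) : Set (Site d)) \ ↑(box d (2 * M₁))) ↑U ↑R} ∩
           {ω : BondConfig (Site d) | ∀ r ∈ R, ∀ r' ∈ R, ∃ v ∈ U, ∃ v' ∈ U,
            s(v, r) ∈ ω ∧ s(v', r') ∈ ω ∧ ω ∈ openConnIn ((↑U : Set (Site d)) \ ↑(box d (2 * M₁ - 1))) v v'})) ≤
      (bondPercolation (zdGraph d) p).real {ω : BondConfig (Site d) | ω ∩ (↑((box d (2 * M₂ + 1)).sym2) : Set (Sym2 (Site d))) ∈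
            explEvent (↑(box d (2 * M₁)) : Set (Site d)) ((↑(box d (2 * M₂)) : Set (Site d)) \ ↑(box d (2 * M₁))) ↑U ↑R} := by
  have _hm : 0 ≤ mm := Nat.zero_le _
  exact measureReal_mono (fun ω hω => hω.2.1.2) (measure_ne_top _ _)

/-- **Positivity of the kernel**: `γ_n(C) > 0` and `β(D) > 0` give `M(C;D) ≥ ϰ a(C) β(D) > 0` (`a(C) ≥ γ_n(C)` by part XIV).
[cite: Kesten1986, §2 Lemma (23)] -/
theorem kernel_pos (p : unitInterval) {ϰ : ℝ} (hϰ : 0 < ϰ)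
    (hA2 : ∀ m : ℕ, 1 ≤ m → ∀ Z : Finset (Site d), box d (4 * m) \ box d (m - 1) ⊆ Z →
      ∀ X : Finset (Site d), X ⊆ Z ∩ box d m → ∀ Y : Finset (Site d), Y ⊆ Z \ box d (4 * m) →
        ϰ * (bondPercolation (zdGraph d) p).real {ω | ∃ x ∈ X, ∃ s ∈ innerBoundary (zdGraph d) (box d (2 * m)),
              ω ∈ openConnIn (↑Z : Set (Site d)) x s} *
          (bondPercolation (zdGraph d) p).real {ω | ∃ y ∈ Y, ∃ s ∈ innerBoundary (zdGraph d) (box d (2 * m)),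
              ω ∈ openConnIn (↑Z : Set (Site d)) y s} ≤
        (bondPercolation (zdGraph d) p).real {ω | ∃ x ∈ X, ∃ y ∈ Y, ω ∈ openConnIn (↑Z : Set (Site d)) x y})
    {mm μ₁ μ₂ M₁ M₂ n : ℕ} (hmμ : 2 * (2 * mm + 1) + 1 ≤ μ₁) (hμ12 : 4 * μ₁ < 2 * μ₂) (hμM : μ₂ ≤ M₁) (hM : M₁ ≤ M₂)
    (hn : 2 * (2 * mm + 1) ≤ n)
    {H X U R : Finset (Site d)} (hH : H ⊆ box d (2 * mm)) (hX : X ⊆ box d (2 * mm + 1)) (hXH : ∀ x ∈ X, x ∉ H)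
    (hUa : box d (2 * M₁) ⊆ U) (hUb : U ⊆ box d (2 * M₂)) (hR : R ⊆ box d (2 * M₂ + 1)) (hRb : ∀ r ∈ R, r ∉ box d (2 * M₂))
    (hγ : 0 < (bondPercolation (zdGraph d) p).real {ω : BondConfig (Site d) | ∃ x ∈ X, ∃ t ∈ innerBoundary (zdGraph d) (box d n),
            ω ∈ openConnIn ((↑(box d n) : Set (Site d)) \ ↑H) x t})
    (hβ : 0 < (∑ I ∈ (box d (2 * μ₂ - 1) \ box d (2 * μ₁ - 1)).powerset ×ˢ (innerBoundary (zdGraph d) (box d (2 * μ₁ - 1))).powerset,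
        (bondPercolation (zdGraph d) p).real {ω : BondConfig (Site d) | ∃ y ∈ I.2, ∃ w ∈ innerBoundary (zdGraph d) (box d (2 * (2 * mm + 1))),
          ω ∈ openConnIn ((↑(box d (2 * μ₂)) : Set (Site d)) \ (↑(I.1 ∪ innerBoundary (zdGraph d) (box d (2 * μ₂))) ∪ ↑(box d (2 * (2 * mm + 1) - 1)))) y w} *
        (bondPercolation (zdGraph d) p).real
          ({ω : BondConfig (Site d) | ω ∩ (↑((box d (2 * μ₂)).sym2) : Set (Sym2 (Site d))) ∈
                explEvent ((↑(box d (2 * μ₂ - 1)) : Set (Site d))ᶜ) ((↑(box d (2 * μ₂ - 1)) : Set (Site d)) \ ↑(box d (2 * μ₁ - 1)))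
                  ((↑(box d (2 * μ₂ - 1)) : Set (Site d))ᶜ ∪ ↑I.1) ↑I.2} ∩
           {ω : BondConfig (Site d) | ∀ y ∈ I.2, ∀ y' ∈ I.2, ∀ z ∈ I.1 ∪ innerBoundary (zdGraph d) (box d (2 * μ₂)),
                ∀ z' ∈ I.1 ∪ innerBoundary (zdGraph d) (box d (2 * μ₂)), s(z, y) ∈ ω → s(z', y') ∈ ω →
                ω ∈ openConnIn (↑(I.1 ∪ innerBoundary (zdGraph d) (box d (2 * μ₂))) : Set (Site d)) z z'} ∩
           {ω : BondConfig (Site d) | ∃ y ∈ I.2, ∃ z ∈ I.1 ∪ innerBoundary (zdGraph d) (box d (2 * μ₂)), s(z, y) ∈ ω ∧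
            ∃ r ∈ R, ∃ v ∈ U, ω ∈ openConnIn ((↑(I.1 ∪ innerBoundary (zdGraph d) (box d (2 * μ₂))) : Set (Site d)) ∪ (↑U \ ↑(box d (2 * μ₂)))) z v ∧
              s(v, r) ∈ ω} ∩
           {ω : BondConfig (Site d) | ω ∩ (↑((box d (2 * M₂ + 1)).sym2) : Set (Sym2 (Site d))) ∈
            explEvent (↑(box d (2 * M₁)) : Set (Site d)) ((↑(box d (2 * M₂)) : Set (Site d)) \ ↑(box d (2 * M₁))) ↑U ↑R} ∩
           {ω : BondConfig (Site d) | ∀ r ∈ R, ∀ r' ∈ R, ∃ v ∈ U, ∃ v' ∈ U,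
            s(v, r) ∈ ω ∧ s(v', r') ∈ ω ∧ ω ∈ openConnIn ((↑U : Set (Site d)) \ ↑(box d (2 * M₁ - 1))) v v'}))) :
    0 < (bondPercolation (zdGraph d) p).real
        ((⋃ I ∈ (box d (2 * μ₂ - 1) \ box d (2 * μ₁ - 1)).powerset ×ˢ (innerBoundary (zdGraph d) (box d (2 * μ₁ - 1))).powerset,
            ({ω : BondConfig (Site d) | ω ∩ (↑((box d (2 * μ₂)).sym2) : Set (Sym2 (Site d))) ∈
                explEvent ((↑(box d (2 * μ₂ - 1)) : Set (Site d))ᶜ) ((↑(box d (2 * μ₂ - 1)) : Set (Site d)) \ ↑(box d (2 * μ₁ - 1)))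
                  ((↑(box d (2 * μ₂ - 1)) : Set (Site d))ᶜ ∪ ↑I.1) ↑I.2} ∩
             {ω : BondConfig (Site d) | ∀ y ∈ I.2, ∀ y' ∈ I.2, ∀ z ∈ I.1 ∪ innerBoundary (zdGraph d) (box d (2 * μ₂)),
                ∀ z' ∈ I.1 ∪ innerBoundary (zdGraph d) (box d (2 * μ₂)), s(z, y) ∈ ω → s(z', y') ∈ ω →
                ω ∈ openConnIn (↑(I.1 ∪ innerBoundary (zdGraph d) (box d (2 * μ₂))) : Set (Site d)) z z'})) ∩
          ({ω : BondConfig (Site d) | ∃ x ∈ X, ∃ r ∈ R, ∃ v ∈ U, ω ∈ openConnIn ((↑U : Set (Site d)) \ ↑H) x v ∧ s(v, r) ∈ ω} ∩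
           {ω : BondConfig (Site d) | ω ∩ (↑((box d (2 * M₂ + 1)).sym2) : Set (Sym2 (Site d))) ∈
            explEvent (↑(box d (2 * M₁)) : Set (Site d)) ((↑(box d (2 * M₂)) : Set (Site d)) \ ↑(box d (2 * M₁))) ↑U ↑R} ∩
           {ω : BondConfig (Site d) | ∀ r ∈ R, ∀ r' ∈ R, ∃ v ∈ U, ∃ v' ∈ U,
            s(v, r) ∈ ω ∧ s(v', r') ∈ ω ∧ ω ∈ openConnIn ((↑U : Set (Site d)) \ ↑(box d (2 * M₁ - 1))) v v'})) := by
  have hH' : H ⊆ box d (2 * mm + 1 - 1) := by rw [Nat.add_sub_cancel]; exact hH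
  have h := (mul_le_kernel_and_kernel_le_mul p hϰ.le hA2 (m := 2 * mm + 1) (by omega) hmμ hμ12 hμM hM hH' hX hXH hUa hUb hR hRb).1
  have ha := real_conn_anti p (H := H) (n := n) (n' := 2 * (2 * mm + 1)) (by omega) hn (hX.trans (box_mono d (by omega)))
  exact lt_of_lt_of_le (mul_pos (mul_pos hϰ (lt_of_lt_of_le hγ ha)) hβ) h

/-- `β(D) = 0 ⇒ M(C;D) = 0`. [cite: Kesten1986, §2 Lemma (23)] -/
theorem kernel_eq_zero_of_beta_eq_zero (p : unitInterval) {ϰ : ℝ} (hϰ : 0 < ϰ)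
    (hA2 : ∀ m : ℕ, 1 ≤ m → ∀ Z : Finset (Site d), box d (4 * m) \ box d (m - 1) ⊆ Z →
      ∀ X : Finset (Site d), X ⊆ Z ∩ box d m → ∀ Y : Finset (Site d), Y ⊆ Z \ box d (4 * m) →
        ϰ * (bondPercolation (zdGraph d) p).real {ω | ∃ x ∈ X, ∃ s ∈ innerBoundary (zdGraph d) (box d (2 * m)),
              ω ∈ openConnIn (↑Z : Set (Site d)) x s} *
          (bondPercolation (zdGraph d) p).real {ω | ∃ y ∈ Y, ∃ s ∈ innerBoundary (zdGraph d) (box d (2 * m)),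
              ω ∈ openConnIn (↑Z : Set (Site d)) y s} ≤
        (bondPercolation (zdGraph d) p).real {ω | ∃ x ∈ X, ∃ y ∈ Y, ω ∈ openConnIn (↑Z : Set (Site d)) x y})
    {mm μ₁ μ₂ M₁ M₂ : ℕ} (hmμ : 2 * (2 * mm + 1) + 1 ≤ μ₁) (hμ12 : 4 * μ₁ < 2 * μ₂) (hμM : μ₂ ≤ M₁) (hM : M₁ ≤ M₂)
    {H X U R : Finset (Site d)} (hH : H ⊆ box d (2 * mm)) (hX : X ⊆ box d (2 * mm + 1)) (hXH : ∀ x ∈ X, x ∉ H)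
    (hUa : box d (2 * M₁) ⊆ U) (hUb : U ⊆ box d (2 * M₂)) (hR : R ⊆ box d (2 * M₂ + 1)) (hRb : ∀ r ∈ R, r ∉ box d (2 * M₂))
    (hβ : (∑ I ∈ (box d (2 * μ₂ - 1) \ box d (2 * μ₁ - 1)).powerset ×ˢ (innerBoundary (zdGraph d) (box d (2 * μ₁ - 1))).powerset,
        (bondPercolation (zdGraph d) p).real {ω : BondConfig (Site d) | ∃ y ∈ I.2, ∃ w ∈ innerBoundary (zdGraph d) (box d (2 * (2 * mm + 1))),
          ω ∈ openConnIn ((↑(box d (2 * μ₂)) : Set (Site d)) \ (↑(I.1 ∪ innerBoundary (zdGraph d) (box d (2 * μ₂))) ∪ ↑(box d (2 * (2 * mm + 1) - 1)))) y w} *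
        (bondPercolation (zdGraph d) p).real
          ({ω : BondConfig (Site d) | ω ∩ (↑((box d (2 * μ₂)).sym2) : Set (Sym2 (Site d))) ∈
                explEvent ((↑(box d (2 * μ₂ - 1)) : Set (Site d))ᶜ) ((↑(box d (2 * μ₂ - 1)) : Set (Site d)) \ ↑(box d (2 * μ₁ - 1)))
                  ((↑(box d (2 * μ₂ - 1)) : Set (Site d))ᶜ ∪ ↑I.1) ↑I.2} ∩
           {ω : BondConfig (Site d) | ∀ y ∈ I.2, ∀ y' ∈ I.2, ∀ z ∈ I.1 ∪ innerBoundary (zdGraph d) (box d (2 * μ₂)),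
                ∀ z' ∈ I.1 ∪ innerBoundary (zdGraph d) (box d (2 * μ₂)), s(z, y) ∈ ω → s(z', y') ∈ ω →
                ω ∈ openConnIn (↑(I.1 ∪ innerBoundary (zdGraph d) (box d (2 * μ₂))) : Set (Site d)) z z'} ∩
           {ω : BondConfig (Site d) | ∃ y ∈ I.2, ∃ z ∈ I.1 ∪ innerBoundary (zdGraph d) (box d (2 * μ₂)), s(z, y) ∈ ω ∧
            ∃ r ∈ R, ∃ v ∈ U, ω ∈ openConnIn ((↑(I.1 ∪ innerBoundary (zdGraph d) (box d (2 * μ₂))) : Set (Site d)) ∪ (↑U \ ↑(box d (2 * μ₂)))) z v ∧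
              s(v, r) ∈ ω} ∩
           {ω : BondConfig (Site d) | ω ∩ (↑((box d (2 * M₂ + 1)).sym2) : Set (Sym2 (Site d))) ∈
            explEvent (↑(box d (2 * M₁)) : Set (Site d)) ((↑(box d (2 * M₂)) : Set (Site d)) \ ↑(box d (2 * M₁))) ↑U ↑R} ∩
           {ω : BondConfig (Site d) | ∀ r ∈ R, ∀ r' ∈ R, ∃ v ∈ U, ∃ v' ∈ U,
            s(v, r) ∈ ω ∧ s(v', r') ∈ ω ∧ ω ∈ openConnIn ((↑U : Set (Site d)) \ ↑(box d (2 * M₁ - 1))) v v'})) = 0) :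
    (bondPercolation (zdGraph d) p).real
        ((⋃ I ∈ (box d (2 * μ₂ - 1) \ box d (2 * μ₁ - 1)).powerset ×ˢ (innerBoundary (zdGraph d) (box d (2 * μ₁ - 1))).powerset,
            ({ω : BondConfig (Site d) | ω ∩ (↑((box d (2 * μ₂)).sym2) : Set (Sym2 (Site d))) ∈
                explEvent ((↑(box d (2 * μ₂ - 1)) : Set (Site d))ᶜ) ((↑(box d (2 * μ₂ - 1)) : Set (Site d)) \ ↑(box d (2 * μ₁ - 1)))
                  ((↑(box d (2 * μ₂ - 1)) : Set (Site d))ᶜ ∪ ↑I.1) ↑I.2} ∩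
             {ω : BondConfig (Site d) | ∀ y ∈ I.2, ∀ y' ∈ I.2, ∀ z ∈ I.1 ∪ innerBoundary (zdGraph d) (box d (2 * μ₂)),
                ∀ z' ∈ I.1 ∪ innerBoundary (zdGraph d) (box d (2 * μ₂)), s(z, y) ∈ ω → s(z', y') ∈ ω →
                ω ∈ openConnIn (↑(I.1 ∪ innerBoundary (zdGraph d) (box d (2 * μ₂))) : Set (Site d)) z z'})) ∩
          ({ω : BondConfig (Site d) | ∃ x ∈ X, ∃ r ∈ R, ∃ v ∈ U, ω ∈ openConnIn ((↑U : Set (Site d)) \ ↑H) x v ∧ s(v, r) ∈ ω} ∩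
           {ω : BondConfig (Site d) | ω ∩ (↑((box d (2 * M₂ + 1)).sym2) : Set (Sym2 (Site d))) ∈
            explEvent (↑(box d (2 * M₁)) : Set (Site d)) ((↑(box d (2 * M₂)) : Set (Site d)) \ ↑(box d (2 * M₁))) ↑U ↑R} ∩
           {ω : BondConfig (Site d) | ∀ r ∈ R, ∀ r' ∈ R, ∃ v ∈ U, ∃ v' ∈ U,
            s(v, r) ∈ ω ∧ s(v', r') ∈ ω ∧ ω ∈ openConnIn ((↑U : Set (Site d)) \ ↑(box d (2 * M₁ - 1))) v v'})) = 0 := by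
  have hH' : H ⊆ box d (2 * mm + 1 - 1) := by rw [Nat.add_sub_cancel]; exact hH
  have h := (mul_le_kernel_and_kernel_le_mul p hϰ.le hA2 (m := 2 * mm + 1) (by omega) hmμ hμ12 hμM hM hH' hX hXH hUa hUb hR hRb).2
  rw [hβ, mul_zero] at h
  exact le_antisymm h measureReal_nonneg

/-- **Hypothesis `hU` of Kesten's scheme** over the index set `s = {D : γ_n(D) > 0, P(DAT(D)) > 0, β(D) > 0}`: for `p > 0`, junk
`α(2μ₁,2μ₂) + α(2M₁,2M₂) ≤ ϰ² ε` and `2M₂ + 2 ≤ N ≤ n`, `4M₂ < N`:  `(1 − ε) γ_N(C) ≤ Σ_{D ∈ s} M(C;D) γ_N(D) ≤ γ_N(C)`.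
[cite: Kesten1986, §2 eq. (22)] -/
theorem scheme_sum_two_sided (p : unitInterval) (hp : 0 < (p : ℝ)) {ϰ ε : ℝ} (hϰ : 0 < ϰ)
    (hA2 : ∀ m : ℕ, 1 ≤ m → ∀ Z : Finset (Site d), box d (4 * m) \ box d (m - 1) ⊆ Z →
      ∀ X : Finset (Site d), X ⊆ Z ∩ box d m → ∀ Y : Finset (Site d), Y ⊆ Z \ box d (4 * m) →
        ϰ * (bondPercolation (zdGraph d) p).real {ω | ∃ x ∈ X, ∃ s ∈ innerBoundary (zdGraph d) (box d (2 * m)),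
              ω ∈ openConnIn (↑Z : Set (Site d)) x s} *
          (bondPercolation (zdGraph d) p).real {ω | ∃ y ∈ Y, ∃ s ∈ innerBoundary (zdGraph d) (box d (2 * m)),
              ω ∈ openConnIn (↑Z : Set (Site d)) y s} ≤
        (bondPercolation (zdGraph d) p).real {ω | ∃ x ∈ X, ∃ y ∈ Y, ω ∈ openConnIn (↑Z : Set (Site d)) x y})
    {mm μ₁ μ₂ M₁ M₂ n N : ℕ} (hmμ : 2 * (2 * mm + 1) + 1 ≤ μ₁) (hμ12 : 4 * μ₁ < 2 * μ₂) (hμM : μ₂ ≤ M₁) (hM : 4 * M₁ < 2 * M₂)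
    (hN : 4 * M₂ < N) (hNn : N ≤ n)
    (hjunk : (bondPercolation (zdGraph d) p).real (boxCrossing d (2 * μ₁) (2 * μ₂)) + (bondPercolation (zdGraph d) p).real (boxCrossing d (2 * M₁) (2 * M₂)) ≤ ϰ ^ 2 * ε)
    {H X : Finset (Site d)} (hH : H ⊆ box d (2 * mm)) (hX : X ⊆ box d (2 * mm + 1)) (hXH : ∀ x ∈ X, x ∉ H) :
    (1 - ε) * (bondPercolation (zdGraph d) p).real {ω : BondConfig (Site d) | ∃ x ∈ X, ∃ t ∈ innerBoundary (zdGraph d) (box d N),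
            ω ∈ openConnIn ((↑(box d N) : Set (Site d)) \ ↑H) x t} ≤
      ∑ D ∈ (((box d (2 * M₂)).powerset.filter (fun U => box d (2 * M₁) ⊆ U)) ×ˢ (box d (2 * M₂ + 1)).powerset).filter (fun D =>
          0 < (bondPercolation (zdGraph d) p).real {ω : BondConfig (Site d) | ∃ x ∈ D.2, ∃ t ∈ innerBoundary (zdGraph d) (box d n),
            ω ∈ openConnIn ((↑(box d n) : Set (Site d)) \ ↑D.1) x t} ∧
          0 < (bondPercolation (zdGraph d) p).real {ω : BondConfig (Site d) | ω ∩ (↑((box d (2 * M₂ + 1)).sym2) : Set (Sym2 (Site d))) ∈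
            explEvent (↑(box d (2 * M₁)) : Set (Site d)) ((↑(box d (2 * M₂)) : Set (Site d)) \ ↑(box d (2 * M₁))) ↑D.1 ↑D.2} ∧
          0 < (∑ I ∈ (box d (2 * μ₂ - 1) \ box d (2 * μ₁ - 1)).powerset ×ˢ (innerBoundary (zdGraph d) (box d (2 * μ₁ - 1))).powerset,
        (bondPercolation (zdGraph d) p).real {ω : BondConfig (Site d) | ∃ y ∈ I.2, ∃ w ∈ innerBoundary (zdGraph d) (box d (2 * (2 * mm + 1))),
          ω ∈ openConnIn ((↑(box d (2 * μ₂)) : Set (Site d)) \ (↑(I.1 ∪ innerBoundary (zdGraph d) (box d (2 * μ₂))) ∪ ↑(box d (2 * (2 * mm + 1) - 1)))) y w} *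
        (bondPercolation (zdGraph d) p).real
          ({ω : BondConfig (Site d) | ω ∩ (↑((box d (2 * μ₂)).sym2) : Set (Sym2 (Site d))) ∈
                explEvent ((↑(box d (2 * μ₂ - 1)) : Set (Site d))ᶜ) ((↑(box d (2 * μ₂ - 1)) : Set (Site d)) \ ↑(box d (2 * μ₁ - 1)))
                  ((↑(box d (2 * μ₂ - 1)) : Set (Site d))ᶜ ∪ ↑I.1) ↑I.2} ∩
           {ω : BondConfig (Site d) | ∀ y ∈ I.2, ∀ y' ∈ I.2, ∀ z ∈ I.1 ∪ innerBoundary (zdGraph d) (box d (2 * μ₂)),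
                ∀ z' ∈ I.1 ∪ innerBoundary (zdGraph d) (box d (2 * μ₂)), s(z, y) ∈ ω → s(z', y') ∈ ω →
                ω ∈ openConnIn (↑(I.1 ∪ innerBoundary (zdGraph d) (box d (2 * μ₂))) : Set (Site d)) z z'} ∩
           {ω : BondConfig (Site d) | ∃ y ∈ I.2, ∃ z ∈ I.1 ∪ innerBoundary (zdGraph d) (box d (2 * μ₂)), s(z, y) ∈ ω ∧
            ∃ r ∈ D.2, ∃ v ∈ D.1, ω ∈ openConnIn ((↑(I.1 ∪ innerBoundary (zdGraph d) (box d (2 * μ₂))) : Set (Site d)) ∪ (↑D.1 \ ↑(box d (2 * μ₂)))) z v ∧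
              s(v, r) ∈ ω} ∩
           {ω : BondConfig (Site d) | ω ∩ (↑((box d (2 * M₂ + 1)).sym2) : Set (Sym2 (Site d))) ∈
            explEvent (↑(box d (2 * M₁)) : Set (Site d)) ((↑(box d (2 * M₂)) : Set (Site d)) \ ↑(box d (2 * M₁))) ↑D.1 ↑D.2} ∩
           {ω : BondConfig (Site d) | ∀ r ∈ D.2, ∀ r' ∈ D.2, ∃ v ∈ D.1, ∃ v' ∈ D.1,
            s(v, r) ∈ ω ∧ s(v', r') ∈ ω ∧ ω ∈ openConnIn ((↑D.1 : Set (Site d)) \ ↑(box d (2 * M₁ - 1))) v v'}))),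
        (bondPercolation (zdGraph d) p).real
        ((⋃ I ∈ (box d (2 * μ₂ - 1) \ box d (2 * μ₁ - 1)).powerset ×ˢ (innerBoundary (zdGraph d) (box d (2 * μ₁ - 1))).powerset,
            ({ω : BondConfig (Site d) | ω ∩ (↑((box d (2 * μ₂)).sym2) : Set (Sym2 (Site d))) ∈
                explEvent ((↑(box d (2 * μ₂ - 1)) : Set (Site d))ᶜ) ((↑(box d (2 * μ₂ - 1)) : Set (Site d)) \ ↑(box d (2 * μ₁ - 1)))
                  ((↑(box d (2 * μ₂ - 1)) : Set (Site d))ᶜ ∪ ↑I.1) ↑I.2} ∩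
             {ω : BondConfig (Site d) | ∀ y ∈ I.2, ∀ y' ∈ I.2, ∀ z ∈ I.1 ∪ innerBoundary (zdGraph d) (box d (2 * μ₂)),
                ∀ z' ∈ I.1 ∪ innerBoundary (zdGraph d) (box d (2 * μ₂)), s(z, y) ∈ ω → s(z', y') ∈ ω →
                ω ∈ openConnIn (↑(I.1 ∪ innerBoundary (zdGraph d) (box d (2 * μ₂))) : Set (Site d)) z z'})) ∩
          ({ω : BondConfig (Site d) | ∃ x ∈ X, ∃ r ∈ D.2, ∃ v ∈ D.1, ω ∈ openConnIn ((↑D.1 : Set (Site d)) \ ↑H) x v ∧ s(v, r) ∈ ω} ∩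
           {ω : BondConfig (Site d) | ω ∩ (↑((box d (2 * M₂ + 1)).sym2) : Set (Sym2 (Site d))) ∈
            explEvent (↑(box d (2 * M₁)) : Set (Site d)) ((↑(box d (2 * M₂)) : Set (Site d)) \ ↑(box d (2 * M₁))) ↑D.1 ↑D.2} ∩
           {ω : BondConfig (Site d) | ∀ r ∈ D.2, ∀ r' ∈ D.2, ∃ v ∈ D.1, ∃ v' ∈ D.1,
            s(v, r) ∈ ω ∧ s(v', r') ∈ ω ∧ ω ∈ openConnIn ((↑D.1 : Set (Site d)) \ ↑(box d (2 * M₁ - 1))) v v'})) *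
        (bondPercolation (zdGraph d) p).real {ω : BondConfig (Site d) | ∃ x ∈ D.2, ∃ t ∈ innerBoundary (zdGraph d) (box d N),
            ω ∈ openConnIn ((↑(box d N) : Set (Site d)) \ ↑D.1) x t} ∧
    ∑ D ∈ (((box d (2 * M₂)).powerset.filter (fun U => box d (2 * M₁) ⊆ U)) ×ˢ (box d (2 * M₂ + 1)).powerset).filter (fun D =>
          0 < (bondPercolation (zdGraph d) p).real {ω : BondConfig (Site d) | ∃ x ∈ D.2, ∃ t ∈ innerBoundary (zdGraph d) (box d n),
            ω ∈ openConnIn ((↑(box d n) : Set (Site d)) \ ↑D.1) x t} ∧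
          0 < (bondPercolation (zdGraph d) p).real {ω : BondConfig (Site d) | ω ∩ (↑((box d (2 * M₂ + 1)).sym2) : Set (Sym2 (Site d))) ∈
            explEvent (↑(box d (2 * M₁)) : Set (Site d)) ((↑(box d (2 * M₂)) : Set (Site d)) \ ↑(box d (2 * M₁))) ↑D.1 ↑D.2} ∧
          0 < (∑ I ∈ (box d (2 * μ₂ - 1) \ box d (2 * μ₁ - 1)).powerset ×ˢ (innerBoundary (zdGraph d) (box d (2 * μ₁ - 1))).powerset,
        (bondPercolation (zdGraph d) p).real {ω : BondConfig (Site d) | ∃ y ∈ I.2, ∃ w ∈ innerBoundary (zdGraph d) (box d (2 * (2 * mm + 1))),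
          ω ∈ openConnIn ((↑(box d (2 * μ₂)) : Set (Site d)) \ (↑(I.1 ∪ innerBoundary (zdGraph d) (box d (2 * μ₂))) ∪ ↑(box d (2 * (2 * mm + 1) - 1)))) y w} *
        (bondPercolation (zdGraph d) p).real
          ({ω : BondConfig (Site d) | ω ∩ (↑((box d (2 * μ₂)).sym2) : Set (Sym2 (Site d))) ∈
                explEvent ((↑(box d (2 * μ₂ - 1)) : Set (Site d))ᶜ) ((↑(box d (2 * μ₂ - 1)) : Set (Site d)) \ ↑(box d (2 * μ₁ - 1)))
                  ((↑(box d (2 * μ₂ - 1)) : Set (Site d))ᶜ ∪ ↑I.1) ↑I.2} ∩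
           {ω : BondConfig (Site d) | ∀ y ∈ I.2, ∀ y' ∈ I.2, ∀ z ∈ I.1 ∪ innerBoundary (zdGraph d) (box d (2 * μ₂)),
                ∀ z' ∈ I.1 ∪ innerBoundary (zdGraph d) (box d (2 * μ₂)), s(z, y) ∈ ω → s(z', y') ∈ ω →
                ω ∈ openConnIn (↑(I.1 ∪ innerBoundary (zdGraph d) (box d (2 * μ₂))) : Set (Site d)) z z'} ∩
           {ω : BondConfig (Site d) | ∃ y ∈ I.2, ∃ z ∈ I.1 ∪ innerBoundary (zdGraph d) (box d (2 * μ₂)), s(z, y) ∈ ω ∧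
            ∃ r ∈ D.2, ∃ v ∈ D.1, ω ∈ openConnIn ((↑(I.1 ∪ innerBoundary (zdGraph d) (box d (2 * μ₂))) : Set (Site d)) ∪ (↑D.1 \ ↑(box d (2 * μ₂)))) z v ∧
              s(v, r) ∈ ω} ∩
           {ω : BondConfig (Site d) | ω ∩ (↑((box d (2 * M₂ + 1)).sym2) : Set (Sym2 (Site d))) ∈
            explEvent (↑(box d (2 * M₁)) : Set (Site d)) ((↑(box d (2 * M₂)) : Set (Site d)) \ ↑(box d (2 * M₁))) ↑D.1 ↑D.2} ∩
           {ω : BondConfig (Site d) | ∀ r ∈ D.2, ∀ r' ∈ D.2, ∃ v ∈ D.1, ∃ v' ∈ D.1,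
            s(v, r) ∈ ω ∧ s(v', r') ∈ ω ∧ ω ∈ openConnIn ((↑D.1 : Set (Site d)) \ ↑(box d (2 * M₁ - 1))) v v'}))),
        (bondPercolation (zdGraph d) p).real
        ((⋃ I ∈ (box d (2 * μ₂ - 1) \ box d (2 * μ₁ - 1)).powerset ×ˢ (innerBoundary (zdGraph d) (box d (2 * μ₁ - 1))).powerset,
            ({ω : BondConfig (Site d) | ω ∩ (↑((box d (2 * μ₂)).sym2) : Set (Sym2 (Site d))) ∈
                explEvent ((↑(box d (2 * μ₂ - 1)) : Set (Site d))ᶜ) ((↑(box d (2 * μ₂ - 1)) : Set (Site d)) \ ↑(box d (2 * μ₁ - 1)))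
                  ((↑(box d (2 * μ₂ - 1)) : Set (Site d))ᶜ ∪ ↑I.1) ↑I.2} ∩
             {ω : BondConfig (Site d) | ∀ y ∈ I.2, ∀ y' ∈ I.2, ∀ z ∈ I.1 ∪ innerBoundary (zdGraph d) (box d (2 * μ₂)),
                ∀ z' ∈ I.1 ∪ innerBoundary (zdGraph d) (box d (2 * μ₂)), s(z, y) ∈ ω → s(z', y') ∈ ω →
                ω ∈ openConnIn (↑(I.1 ∪ innerBoundary (zdGraph d) (box d (2 * μ₂))) : Set (Site d)) z z'})) ∩
          ({ω : BondConfig (Site d) | ∃ x ∈ X, ∃ r ∈ D.2, ∃ v ∈ D.1, ω ∈ openConnIn ((↑D.1 : Set (Site d)) \ ↑H) x v ∧ s(v, r) ∈ ω} ∩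
           {ω : BondConfig (Site d) | ω ∩ (↑((box d (2 * M₂ + 1)).sym2) : Set (Sym2 (Site d))) ∈
            explEvent (↑(box d (2 * M₁)) : Set (Site d)) ((↑(box d (2 * M₂)) : Set (Site d)) \ ↑(box d (2 * M₁))) ↑D.1 ↑D.2} ∩
           {ω : BondConfig (Site d) | ∀ r ∈ D.2, ∀ r' ∈ D.2, ∃ v ∈ D.1, ∃ v' ∈ D.1,
            s(v, r) ∈ ω ∧ s(v', r') ∈ ω ∧ ω ∈ openConnIn ((↑D.1 : Set (Site d)) \ ↑(box d (2 * M₁ - 1))) v v'})) *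
        (bondPercolation (zdGraph d) p).real {ω : BondConfig (Site d) | ∃ x ∈ D.2, ∃ t ∈ innerBoundary (zdGraph d) (box d N),
            ω ∈ openConnIn ((↑(box d N) : Set (Site d)) \ ↑D.1) x t} ≤
      (bondPercolation (zdGraph d) p).real {ω : BondConfig (Site d) | ∃ x ∈ X, ∃ t ∈ innerBoundary (zdGraph d) (box d N),
            ω ∈ openConnIn ((↑(box d N) : Set (Site d)) \ ↑H) x t} := by
  classical
  have LS := sum_kernel_mul_conn_two_sided p hϰ hA2 (μ₁ := μ₁) (μ₂ := μ₂) (M₁ := M₁) (M₂ := M₂) (n := N) (by omega) hμ12 hμM hM hN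
    (hH.trans (box_mono d (by omega))) (hX.trans (box_mono d (by omega))) hXH
  rw [Finset.sum_filter_of_ne]
  · refine ⟨le_trans (mul_le_mul_of_nonneg_right ?_ measureReal_nonneg) LS.1, LS.2⟩
    -- `1 − ε ≤ 1 − ϰ⁻² (α + α)`
    have hϰ2 : 0 < ϰ ^ 2 := by positivity
    have : ϰ⁻¹ ^ 2 * ((bondPercolation (zdGraph d) p).real (boxCrossing d (2 * μ₁) (2 * μ₂)) + (bondPercolation (zdGraph d) p).real (boxCrossing d (2 * M₁) (2 * M₂))) ≤ ε := by
      rw [inv_pow, inv_mul_le_iff₀ hϰ2]; exact hjunk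
    linarith
  · -- dropped data contribute nothing
    intro D hD hne
    rw [Finset.mem_product, Finset.mem_filter, Finset.mem_powerset, Finset.mem_powerset] at hD
    obtain ⟨⟨hUb, hUa⟩, hR⟩ := hD
    have hK0 := (mul_ne_zero_iff.1 hne).1
    have hγ0 := (mul_ne_zero_iff.1 hne).2
    have hγN : 0 < (bondPercolation (zdGraph d) p).real {ω : BondConfig (Site d) | ∃ x ∈ D.2, ∃ t ∈ innerBoundary (zdGraph d) (box d N),
            ω ∈ openConnIn ((↑(box d N) : Set (Site d)) \ ↑D.1) x t} :=
      lt_of_le_of_ne measureReal_nonneg (Ne.symm hγ0)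
    have hdat : 0 < (bondPercolation (zdGraph d) p).real {ω : BondConfig (Site d) | ω ∩ (↑((box d (2 * M₂ + 1)).sym2) : Set (Sym2 (Site d))) ∈
            explEvent (↑(box d (2 * M₁)) : Set (Site d)) ((↑(box d (2 * M₂)) : Set (Site d)) \ ↑(box d (2 * M₁))) ↑D.1 ↑D.2} :=
      lt_of_lt_of_le (lt_of_le_of_ne measureReal_nonneg (Ne.symm hK0)) (kernel_le_dat p mm μ₁ μ₂ M₁ M₂ H X D.1 D.2)
    have hRb : ∀ r ∈ D.2, r ∉ box d (2 * M₂) := fun r hr hrb =>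
      hdat.ne' (real_dat_eq_zero_of_mem_box p (by omega) hUb hr hrb)
    refine ⟨real_conn_pos_of_real_conn_pos p hp (b := 2 * M₂) (by omega) hNn hUb hγN, hdat, ?_⟩
    refine lt_of_le_of_ne (Finset.sum_nonneg fun I _ => mul_nonneg measureReal_nonneg measureReal_nonneg) fun h0 => hK0 ?_
    exact kernel_eq_zero_of_beta_eq_zero p hϰ hA2 hmμ hμ12 hμM (by omega) hH hX hXH hUa hUb hR hRb h0.symm


end Summit.CriticalPhenomena.PercolationContinuityZ3.Theorems.Crossing

end
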